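import Literature.Computability.Complexity.Space
import Literature.Computability.Complexity.SpaceLoop
import Mathlib.Tactic.DeriveFintype
import HarnessLib

/-!
# `DTIME(T) ⊆ SPACE(T)`: a time-bounded machine as an input-preserving space machine

Trunk `CplxCore`, toolkit for `Space.lean` (the tree's space machines `SpaceMachine`,
`DecidesInSpace`, `SpaceClass`, `DSPACE`, after Arora–Barak 2009, Def. 4.1), sibling of
`SpaceLoop.lean` (whose bookkeeping — `SpaceLoop.RunsVia`, `SpaceLoop.stkLen` — and machine
layout this file adapts). It supplies the machine behind the first inclusion of Arora–Barak's
Thm. 4.2, `DTIME(S(n)) ⊆ SPACE(S(n))` (book §4.1, right after Def. 4.1: "since a TM can access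
only one tape cell per step"; proof of Thm. 4.2 in §4.1.1: "Clearly `DTIME(S(n)) ⊆ SPACE(S(n))`"),
for Mathlib's multi-stack machines `Turing.FinTM2` and the read-only-input space machines of
`Space.lean`; the discharge
`Literature.Computability.Complexity.DTIME_subset_DSPACE_holds` of the named fact
`DTIME_subset_DSPACE` (`Space.lean`) is the corollary in `SpaceProofs.lean`.

* `TimeToSpace.simTM M dflt`, `TimeToSpace.spaceMachine Mx dflt` — for a bundled `M : Turing.FinTM2`
  (resp. `Mx : Turing.TM2ComputableAux Γ₀ Γ₁`) the machine with stacks `M.K ⊕ Aux` (two auxiliary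
  stacks `IN`, the input stack, and `LEFT`, the left input stack, both over the input alphabet
  `M.Γ M.k₀`), labels `M.Λ ⊕ Ctrl` (control labels `load`, `feed`) and states
  `M.σ × Option (M.Γ M.k₀)` (a register for one popped symbol). Control flow
  (`TimeToSpace.ctrlStmt`): `load` pops `IN` symbol by symbol onto `LEFT`; `feed` pops `LEFT`
  symbol by symbol back onto `IN` and, simultaneously, onto the input stack `inl k₀` of `M` (the two
  reversals restore the order), then jumps to `M.main`; the statements of `M` act verbatim on the
  `inl` stacks and the first state component (`TimeToSpace.trStmt`, `halt ↦ halt`). Throughout,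
  `reverse LEFT ++ IN` is the input (`SpaceMachine.IsInputPreserving`), and `M` halts in Mathlib's
  `haltList` form with its answer on `inl k₁`, the output stack of the space machine.
* `TimeToSpace.popBound`, `TimeToSpace.machinePopBound`, `TimeToSpace.stkLen_le_of_iterate` — one
  step of a `FinTM2` SHORTENS the total stack contents by at most `P = machinePopBound` symbols
  (finitely many labels, each statement pops boundedly often). Read backwards from the halting
  configuration `haltList out` (all stacks but the output empty), a run of `n` steps never holds
  more than `|out| + P · n` symbols (`TimeToSpace.stkLen_le_of_run`) — in particular the input
  length itself is `≤ |out| + P · n` (Mathlib's halting convention makes the machine consume its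
  input), so no hypothesis `T(n) ≥ n` is needed.
* `TimeToSpace.decidesInSpace` — **main result**: if `Mx` decides `L` within `T |x|` steps
  (`DecidesInTime id L (T ∘ length) Mx`), then `spaceMachine Mx _` decides `L` in work space
  `1 + machinePopBound Mx.tm * T |x|` with read-only input; `TimeToSpace.timeClass_subset_spaceClass`:
  `TimeClass T ⊆ SpaceClass (fun n => 1 + P * T n)` for the machine's constant `P`.

Mathlib has no space-bounded machines (see the module docstring of `Space.lean`); we reuse
`Turing.initList`, `Turing.haltList`, `Turing.TM2.stepAux`, `StateTransition.Reaches/eval`, and from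
the tree `TM2Comp.iterate_bind_map`, `TM2Comp.initList_eq/haltList_eq` (`TimeBoundsProofs.lean`),
`TM2Iter.reachesIn_of_outputsWithin` (`TM2Iterate.lean`), `SpaceLoop.RunsVia`, `SpaceLoop.stkLen`
(`SpaceLoop.lean`).

## References

* S. Arora, B. Barak, *Computational Complexity: A Modern Approach*, CUP 2009, Def. 4.1 (space
  bounded computation: read-only input, only work tapes are charged), Thm. 4.2 and its proof
  (`DTIME(S(n)) ⊆ SPACE(S(n))`: one tape cell per step), §4.1–§4.1.1. [AroraBarak2009] (held:
  `book:arora2009-computational-complexity-modern-approach`, text chunks 105–108). The book states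
  Thm. 4.2 for space-constructible `S`; constructibility serves its last inclusion
  `NSPACE(S) ⊆ DTIME(2^{O(S)})` only, the first one holds for every `S` (as here).
* M. Sipser, *Introduction to the Theory of Computation*, 3rd ed., proof of Thm. 8.5 ff. (a machine
  running in time `t(n)` uses at most `t(n)` space).
* Mathlib, `Mathlib/Computability/TuringMachine/Computable.lean` (`FinTM2`, `initList`, `haltList`,
  `TM2OutputsInTime`).

## Design notes

* The auxiliary stacks carry the alphabet `M.Γ M.k₀` of the input stack of `M`, so that the space
  machine's alphabet identifications are those of `Mx` and the copy onto `inl k₀` needs no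
  conversion; the one total `push` function needs a default symbol `dflt : M.Γ M.k₀` (for
  `Mx : TM2ComputableAux Bool Bool`, `Mx.inputAlphabet.symm false`), never actually pushed.
* The space bound is obtained from POPS, not pushes: bounding pushes forward from `initList`
  (`TM2Comp.length_iterate_le`) would leave the input length `n` in the bound, whereas counting pops
  backwards from `haltList` bounds every configuration of the run, the initial one included, by
  `|out| + P · T(n)`; hence `DTIME t ⊆ DSPACE t` for every `t : ℕ → ℕ` whatsoever (the classes
  `TimeClass t` being empty when `t` is too small).
-/

namespace Literature.Computability.Complexity

namespace TimeToSpace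

open Turing StateTransition Function TM2Comp _root_.Computability

/-! ### Stack shrinkage per step: the pop bound -/

section PopBound

variable {K : Type} {Γ : K → Type} {Λ σ : Type}

/-- The maximal number of `pop` instructions along an execution path of a TM2 statement.
[folklore] -/
def popBound : TM2.Stmt Γ Λ σ → ℕ
  | TM2.Stmt.push _ _ q => popBound q
  | TM2.Stmt.peek _ _ q => popBound q
  | TM2.Stmt.pop _ _ q => popBound q + 1
  | TM2.Stmt.load _ q => popBound q
  | TM2.Stmt.branch _ q₁ q₂ => max (popBound q₁) (popBound q₂)
  | TM2.Stmt.goto _ => 0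
  | TM2.Stmt.halt => 0

end PopBound

section Run

variable (M : FinTM2)

/-- Executing one statement shortens the total stack contents by at most `popBound` symbols
(a `pop` removes at most one symbol, nothing else removes any). [folklore] -/
theorem stkLen_le_stepAux (q : TM2.Stmt M.Γ M.Λ M.σ) (v : M.σ) (S : ∀ k, List (M.Γ k)) :
    SpaceLoop.stkLen M S ≤ SpaceLoop.stkLen M (TM2.stepAux q v S).stk + popBound q := by
  induction q generalizing v S with
  | push k f q ih =>
    simp only [TM2.stepAux, popBound]
    refine le_trans ?_ (ih _ _)
    have := SpaceLoop.stkLen_update M S k (f v :: S k)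
    simp only [List.length_cons] at this
    omega
  | peek k f q ih => simp only [TM2.stepAux, popBound]; exact ih _ _
  | pop k f q ih =>
    simp only [TM2.stepAux, popBound]
    have h1 := SpaceLoop.stkLen_update M S k (S k).tail
    have h2 : (S k).length ≤ (S k).tail.length + 1 := by
      rw [List.length_tail]; omega
    have h3 := ih (f v (S k).head?) (update S k (S k).tail)
    omega
  | load f q ih => simp only [TM2.stepAux, popBound]; exact ih _ _
  | branch p q₁ q₂ ih₁ ih₂ =>
    simp only [TM2.stepAux, popBound]
    cases p v
    · exact (ih₂ _ _).trans (Nat.add_le_add_left (le_max_right _ _) _)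
    · exact (ih₁ _ _).trans (Nat.add_le_add_left (le_max_left _ _) _)
  | goto l => simp [TM2.stepAux, popBound]
  | halt => simp [TM2.stepAux, popBound]

/-- A uniform bound on the number of pops performed by one step of a `FinTM2`. [folklore] -/
noncomputable def machinePopBound : ℕ :=
  letI := M.ΛFin
  Finset.univ.sup fun l => popBound (M.m l)

/-- One step of a `FinTM2` shortens the total stack contents by at most `machinePopBound`
symbols. [folklore] -/
theorem stkLen_le_step (c d : M.Cfg) (h : M.step c = some d) :
    SpaceLoop.stkLen M c.stk ≤ SpaceLoop.stkLen M d.stk + machinePopBound M := by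
  letI := M.ΛFin
  obtain ⟨_ | l, v, S⟩ := c
  · simp [FinTM2.step, TM2.step] at h
  · simp only [FinTM2.step, TM2.step] at h
    obtain rfl := Option.some.inj h
    refine (stkLen_le_stepAux M _ _ _).trans (Nat.add_le_add_left ?_ _)
    exact Finset.le_sup (f := fun l => popBound (M.m l)) (Finset.mem_univ l)

/-- `n` steps of a `FinTM2` shorten the total stack contents by at most `machinePopBound * n`
symbols: read backwards, the START of an `n`-step run holds at most `machinePopBound * n` symbols
more than its end. [cite: AroraBarak2009, Thm. 4.2 (proof: one tape cell per step)] -/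
theorem stkLen_le_of_iterate {n : ℕ} : ∀ {c d : M.Cfg}, (flip bind M.step)^[n] (some c) = some d →
    SpaceLoop.stkLen M c.stk ≤ SpaceLoop.stkLen M d.stk + machinePopBound M * n := by
  induction n with
  | zero =>
    intro c d h
    simp only [iterate_zero, id_eq, Option.some.injEq] at h
    simp [h]
  | succ n ih =>
    intro c d h
    rw [iterate_bind_succ] at h
    cases hfc : M.step c with
    | none => rw [hfc, iterate_bind_none] at h; cases h
    | some c' =>
      rw [hfc] at h
      have h1 := stkLen_le_step M c c' hfc
      have h2 := ih h
      rw [Nat.mul_succ]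
      omega

/-- **Space along a halting run, from its end.** Every configuration `d` met `j ≤ n` steps into an
`n`-step run from `a` to `b` holds at most `stkLen b + machinePopBound * n` symbols in total.
[cite: AroraBarak2009, Thm. 4.2 (DTIME(S) ⊆ SPACE(S))] -/
theorem stkLen_le_of_run {n j : ℕ} {a b d : M.Cfg} (h : (flip bind M.step)^[n] (some a) = some b)
    (hj : j ≤ n) (hd : (flip bind M.step)^[j] (some a) = some d) :
    SpaceLoop.stkLen M d.stk ≤ SpaceLoop.stkLen M b.stk + machinePopBound M * n := by
  obtain ⟨i, rfl⟩ := Nat.exists_eq_add_of_le hj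
  have e : (flip bind M.step)^[i] (some d) = some b := by
    rw [← hd, ← iterate_add_apply, Nat.add_comm]; exact h
  have h1 := stkLen_le_of_iterate M e
  have h2 : machinePopBound M * i ≤ machinePopBound M * (j + i) := Nat.mul_le_mul_left _ (by omega)
  omega

/-- Total length of the halting configuration of `M` with output `L`. [folklore] -/
@[simp] theorem stkLen_haltList (L : List (M.Γ M.k₁)) :
    SpaceLoop.stkLen M (haltList M L).stk = L.length := by
  rw [haltList_eq]; exact SpaceLoop.stkLen_update_bot M M.k₁ L

end Run

/-! ### The simulating machine: auxiliary stacks, control labels, alphabets -/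

/-- The two auxiliary stacks of the simulating machine: the input stack `IN` and the left input
stack `LEFT` (together the read-only input of the space machine). [folklore] -/
inductive Aux
  | IN
  | LEFT
  deriving DecidableEq, Fintype

/-- The control labels of the simulating machine (besides the labels of the simulated machine):
`load` (move the input onto `LEFT`) and `feed` (move it back onto `IN`, pushing a copy on the input
stack of the simulated machine, then start it). [folklore] -/
inductive Ctrl
  | load
  | feed
  deriving DecidableEq, Fintype

section Machine

variable {K : Type} {G : K → Type} {Λ σ : Type} (k₀ : K)

/-- Stack alphabets of the simulating machine: those of the simulated machine on `inl`, the input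
alphabet `G k₀` on the two auxiliary stacks. Written with `casesOn` so that it unfolds by `rfl` on
constructors. [folklore] -/
abbrev TSΓ (G : K → Type) (k₀ : K) : K ⊕ Aux → Type := fun j =>
  Sum.casesOn (motive := fun _ => Type) j G (fun _ => G k₀)

/-- Internal states of the simulating machine: a state of the simulated machine and a register for
one popped input symbol (`none` between control steps and during the simulation). [folklore] -/
abbrev St (G : K → Type) (k₀ : K) (σ : Type) : Type := σ × Option (G k₀)

/-- Stack contents of the simulating machine from the stacks `S` of the simulated machine and the
contents `i`, `lf` of `IN`, `LEFT`. [folklore] -/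
def mkStk (S : ∀ k, List (G k)) (i lf : List (G k₀)) : ∀ j : K ⊕ Aux, List (TSΓ G k₀ j)
  | Sum.inl k => S k
  | Sum.inr Aux.IN => i
  | Sum.inr Aux.LEFT => lf

section StkLemmas

variable (S : ∀ k, List (G k)) (i lf : List (G k₀))

/-- Reading a stack of the simulated machine. [folklore] -/
@[simp] theorem mkStk_inl (k : K) : mkStk k₀ S i lf (Sum.inl k) = S k := rfl
/-- Reading `IN`. [folklore] -/
@[simp] theorem mkStk_IN : mkStk k₀ S i lf (Sum.inr Aux.IN) = i := rfl
/-- Reading `LEFT`. [folklore] -/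
@[simp] theorem mkStk_LEFT : mkStk k₀ S i lf (Sum.inr Aux.LEFT) = lf := rfl

variable {dKA : DecidableEq (K ⊕ Aux)}

/-- Writing a stack of the simulated machine (any decidability instance on `K ⊕ Aux`, so that the
lemma also fires on the instance bundled in a `FinTM2`). [folklore] -/
@[simp] theorem mkStk_update_inl [DecidableEq K] (k : K) (L : List (G k)) :
    @update _ _ dKA (mkStk k₀ S i lf) (Sum.inl k) L = mkStk k₀ (update S k L) i lf := by
  funext j
  rcases j with k' | a
  · rcases eq_or_ne k' k with rfl | h
    · simp
    · rw [update_of_ne (by simpa using h)]; simp [update_of_ne h]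
  · rw [update_of_ne (by simp)]; cases a <;> rfl

/-- Writing `IN`. [folklore] -/
@[simp] theorem mkStk_update_IN (i' : List (G k₀)) :
    @update _ _ dKA (mkStk k₀ S i lf) (Sum.inr Aux.IN) i' = mkStk k₀ S i' lf := by
  funext j
  rcases j with k' | a
  · rw [update_of_ne (by simp)]; rfl
  · cases a
    · simp
    · rw [update_of_ne (by simp)]; rfl

/-- Writing `LEFT`. [folklore] -/
@[simp] theorem mkStk_update_LEFT (lf' : List (G k₀)) :
    @update _ _ dKA (mkStk k₀ S i lf) (Sum.inr Aux.LEFT) lf' = mkStk k₀ S i lf' := by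
  funext j
  rcases j with k' | a
  · rw [update_of_ne (by simp)]; rfl
  · cases a
    · rw [update_of_ne (by simp)]; rfl
    · simp

/-- The empty stack assignment. [folklore] -/
theorem mkStk_bot :
    mkStk k₀ (fun k => ([] : List (G k))) [] [] = fun j => ([] : List (TSΓ G k₀ j)) := by
  funext j
  rcases j with k | a
  · rfl
  · cases a <;> rfl

/-- The initial stack assignment of the simulating machine (input word on `IN`). [folklore] -/
theorem mkStk_bot_IN [DecidableEq K] (l : List (G k₀)) :
    mkStk k₀ (fun k => ([] : List (G k))) l [] =
      update (fun j => ([] : List (TSΓ G k₀ j))) (Sum.inr Aux.IN) l := by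
  rw [← mkStk_bot, mkStk_update_IN]

end StkLemmas

/-- Translation of the statements of the simulated machine: act on the `inl` stacks and the first
state component; `halt` stays `halt`. [folklore] -/
def trStmt : TM2.Stmt G Λ σ → TM2.Stmt (TSΓ G k₀) (Λ ⊕ Ctrl) (St G k₀ σ)
  | TM2.Stmt.push k f q => TM2.Stmt.push (Sum.inl k) (fun s => f s.1) (trStmt q)
  | TM2.Stmt.peek k f q => TM2.Stmt.peek (Sum.inl k) (fun s x => (f s.1 x, s.2)) (trStmt q)
  | TM2.Stmt.pop k f q => TM2.Stmt.pop (Sum.inl k) (fun s x => (f s.1 x, s.2)) (trStmt q)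
  | TM2.Stmt.load f q => TM2.Stmt.load (fun s => (f s.1, s.2)) (trStmt q)
  | TM2.Stmt.branch p q₁ q₂ => TM2.Stmt.branch (fun s => p s.1) (trStmt q₁) (trStmt q₂)
  | TM2.Stmt.goto l => TM2.Stmt.goto fun s => Sum.inl (l s.1)
  | TM2.Stmt.halt => TM2.Stmt.halt

/-- Configuration of the simulating machine while the simulated machine runs: `IN` holds the input
`i`, `LEFT` is empty, the register is reset; labels along `inl` (`none ↦ none`). [folklore] -/
def cfgM (c : TM2.Cfg G Λ σ) (i : List (G k₀)) : TM2.Cfg (TSΓ G k₀) (Λ ⊕ Ctrl) (St G k₀ σ) :=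
  ⟨c.l.map Sum.inl, (c.var, none), mkStk k₀ c.stk i []⟩

/-- One statement of the simulated machine is simulated exactly by its translation. [folklore] -/
theorem stepAux_trStmt [DecidableEq K] (q : TM2.Stmt G Λ σ) (v : σ) (S : ∀ k, List (G k))
    (i : List (G k₀)) :
    TM2.stepAux (trStmt k₀ q) ((v, none) : St G k₀ σ) (mkStk k₀ S i []) =
      cfgM k₀ (TM2.stepAux q v S) i := by
  induction q generalizing v S with
  | push k f q ih =>
    simp only [trStmt, TM2.stepAux]
    rw [← ih, mkStk_inl, mkStk_update_inl]
  | peek k f q ih => simp only [trStmt, TM2.stepAux]; exact ih _ _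
  | pop k f q ih =>
    simp only [trStmt, TM2.stepAux]
    rw [← ih, mkStk_inl, mkStk_update_inl]
  | load f q ih => simp only [trStmt, TM2.stepAux]; exact ih _ _
  | branch p q₁ q₂ ih₁ ih₂ =>
    simp only [trStmt, TM2.stepAux]
    cases p v
    · exact ih₂ _ _
    · exact ih₁ _ _
  | goto l => rfl
  | halt => rfl

variable (main : Λ) (dflt : G k₀)

/-- The control statements of the simulating machine.
* `load`: pop the input stack `IN` symbol by symbol, pushing each symbol on `LEFT` (so that
  `reverse LEFT ++ IN` is always the input: the read-only input convention of space machines);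
  when `IN` is exhausted, continue with `feed`;
* `feed`: pop `LEFT` symbol by symbol, pushing each symbol back on `IN` and on the input stack `k₀`
  of the simulated machine (this second reversal restores the order); when `LEFT` is exhausted,
  jump to the main label of the simulated machine.
The register holds the popped symbol within a step and is reset before the step ends; `dflt` makes
the `push` functions total and is never pushed. [cite: AroraBarak2009, Def. 4.1 and Thm. 4.2 (read-only input; the work tape copy of the input)] -/
def ctrlStmt : Ctrl → TM2.Stmt (TSΓ G k₀) (Λ ⊕ Ctrl) (St G k₀ σ)
  | Ctrl.load =>
      TM2.Stmt.pop (Sum.inr Aux.IN) (fun v a => (v.1, a)) <|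
        TM2.Stmt.branch (fun v => v.2.isNone)
          (TM2.Stmt.goto fun _ => Sum.inr Ctrl.feed)
          (TM2.Stmt.push (Sum.inr Aux.LEFT) (fun v => v.2.getD dflt) <|
            TM2.Stmt.load (fun v => (v.1, none)) <| TM2.Stmt.goto fun _ => Sum.inr Ctrl.load)
  | Ctrl.feed =>
      TM2.Stmt.pop (Sum.inr Aux.LEFT) (fun v a => (v.1, a)) <|
        TM2.Stmt.branch (fun v => v.2.isNone)
          (TM2.Stmt.goto fun _ => Sum.inl main)
          (TM2.Stmt.push (Sum.inr Aux.IN) (fun v => v.2.getD dflt) <|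
            TM2.Stmt.push (Sum.inl k₀) (fun v => v.2.getD dflt) <|
              TM2.Stmt.load (fun v => (v.1, none)) <| TM2.Stmt.goto fun _ => Sum.inr Ctrl.feed)

end Machine

/-! ### Bundling: the simulating machine as a `FinTM2` and as a space machine -/

section Bundled

variable (M : FinTM2) (dflt : M.Γ M.k₀)

/-- Configurations of the simulating machine with reset register, from the label, the `M`-state, the
stacks of `M` and the two auxiliary stacks. [folklore] -/
def cfg (l : Option (M.Λ ⊕ Ctrl)) (v : M.σ) (S : ∀ k, List (M.Γ k)) (i lf : List (M.Γ M.k₀)) :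
    TM2.Cfg (TSΓ M.Γ M.k₀) (M.Λ ⊕ Ctrl) (St M.Γ M.k₀ M.σ) :=
  ⟨l, (v, none), mkStk M.k₀ S i lf⟩

/-- The (unbundled) type of configurations of the simulating machine. [folklore] -/
abbrev TCfg : Type := TM2.Cfg (TSΓ M.Γ M.k₀) (M.Λ ⊕ Ctrl) (St M.Γ M.k₀ M.σ)

/-- **The simulating machine** of a bundled TM2 machine `M`: stacks `M.K ⊕ Aux` (input stack `IN`,
output stack `inl k₁`), labels `M.Λ ⊕ Ctrl` (main label `load`), states
`M.σ × Option (M.Γ M.k₀)`. On input `l` it moves `l` onto `LEFT`, then back onto `IN` with a copy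
on `inl k₀`, and runs `M` on its own stacks. [cite: AroraBarak2009, Thm. 4.2 (DTIME(S) ⊆ SPACE(S))] -/
noncomputable def simTM : FinTM2 :=
  letI := M.kFin; letI := M.ΛFin; letI := M.σFin; letI := M.Γk₀Fin
  { K := M.K ⊕ Aux
    k₀ := Sum.inr Aux.IN
    k₁ := Sum.inl M.k₁
    Γ := TSΓ M.Γ M.k₀
    Λ := M.Λ ⊕ Ctrl
    main := Sum.inr Ctrl.load
    σ := St M.Γ M.k₀ M.σ
    initialState := (M.initialState, none)
    Γk₀Fin := M.Γk₀Fin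
    m := fun l => match l with
      | Sum.inl l => trStmt M.k₀ (M.m l)
      | Sum.inr c => ctrlStmt M.k₀ M.main dflt c }

/-- A step of the simulating machine at a control label, unbundled. [folklore] -/
theorem step_inr (c : Ctrl) (var : St M.Γ M.k₀ M.σ) (stk : ∀ j, List (TSΓ M.Γ M.k₀ j)) :
    (simTM M dflt).step (⟨some (Sum.inr c), var, stk⟩ : TCfg M) =
      some (TM2.stepAux (ctrlStmt M.k₀ M.main dflt c) var stk) :=
  rfl

/-- A step of the simulating machine at a label of the simulated machine, unbundled. [folklore] -/
theorem step_inl (l : M.Λ) (var : St M.Γ M.k₀ M.σ) (stk : ∀ j, List (TSΓ M.Γ M.k₀ j)) :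
    (simTM M dflt).step (⟨some (Sum.inl l), var, stk⟩ : TCfg M) =
      some (TM2.stepAux (trStmt M.k₀ (M.m l)) var stk) :=
  rfl

/-- The halted simulating machine does not move. [folklore] -/
theorem step_none (var : St M.Γ M.k₀ M.σ) (stk : ∀ j, List (TSΓ M.Γ M.k₀ j)) :
    (simTM M dflt).step (⟨none, var, stk⟩ : TCfg M) = none :=
  rfl

/-! ### Single steps of the control labels, and the simulation of `M` -/

section Steps

variable (v : M.σ) (S : ∀ k, List (M.Γ k)) (i lf : List (M.Γ M.k₀))

/-- `load` on a nonempty input stack: the symbol goes to `LEFT`. [folklore] -/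
theorem step_load_cons (s : M.Γ M.k₀) :
    (simTM M dflt).step (cfg M (some (Sum.inr Ctrl.load)) v S (s :: i) lf) =
      some (cfg M (some (Sum.inr Ctrl.load)) v S i (s :: lf)) := by
  rw [cfg, step_inr]; simp [ctrlStmt, cfg]

/-- `load` on an empty input stack: proceed to `feed`. [folklore] -/
theorem step_load_nil :
    (simTM M dflt).step (cfg M (some (Sum.inr Ctrl.load)) v S [] lf) =
      some (cfg M (some (Sum.inr Ctrl.feed)) v S [] lf) := by
  rw [cfg, step_inr]; simp [ctrlStmt, cfg]

/-- `feed` on a nonempty `LEFT`: the symbol goes back to `IN` and, as a copy, to `k₀`. [folklore] -/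
theorem step_feed_cons (s : M.Γ M.k₀) :
    (simTM M dflt).step (cfg M (some (Sum.inr Ctrl.feed)) v S i (s :: lf)) =
      some (cfg M (some (Sum.inr Ctrl.feed)) v (update S M.k₀ (s :: S M.k₀)) (s :: i) lf) := by
  rw [cfg, step_inr]; simp [ctrlStmt, cfg]

/-- `feed` on an empty `LEFT`: start the simulated machine. [folklore] -/
theorem step_feed_nil :
    (simTM M dflt).step (cfg M (some (Sum.inr Ctrl.feed)) v S i []) =
      some (cfg M (some (Sum.inl M.main)) v S i []) := by
  rw [cfg, step_inr]; simp [ctrlStmt, cfg]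

/-- A step of the simulated machine `M` is a step of the simulating machine on the embedded
configuration. [folklore] -/
theorem step_cfgM (a b : M.Cfg) (h : M.step a = some b) (i : List (M.Γ M.k₀)) :
    (simTM M dflt).step (cfgM M.k₀ a i) = some (cfgM M.k₀ b i) := by
  obtain ⟨_ | l, w, S'⟩ := a
  · simp [FinTM2.step, TM2.step] at h
  · simp only [FinTM2.step, TM2.step] at h
    obtain rfl := Option.some.inj h
    show (simTM M dflt).step (⟨some (Sum.inl l), (w, none), mkStk M.k₀ S' i []⟩ : TCfg M) = _
    rw [step_inl, stepAux_trStmt]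

end Steps

/-! ### Phases of the simulating machine (runs through a predicate) -/

section Phases

variable (P : TCfg M → Prop) (v : M.σ) (S : ∀ k, List (M.Γ k))

/-- `load`: the input `i` is moved onto `LEFT` (reversed), then the machine proceeds to `feed`; the
run stays inside `P` if all the displayed configurations satisfy `P`. [folklore] -/
theorem load_run (lf : List (M.Γ M.k₀)) : ∀ i : List (M.Γ M.k₀),
    (∀ i₁ i₂, i₁ ++ i₂ = i → P (cfg M (some (Sum.inr Ctrl.load)) v S i₂ (i₁.reverse ++ lf))) →
    P (cfg M (some (Sum.inr Ctrl.feed)) v S [] (i.reverse ++ lf)) →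
    SpaceLoop.RunsVia (C := TCfg M) (simTM M dflt).step P
      (cfg M (some (Sum.inr Ctrl.load)) v S i lf)
      (cfg M (some (Sum.inr Ctrl.feed)) v S [] (i.reverse ++ lf)) := by
  intro i
  induction i generalizing lf with
  | nil =>
    intro hP hend
    simpa using SpaceLoop.RunsVia.single (step_load_nil M dflt v S lf) (by simpa using hP [] [] rfl)
      (by simpa using hend)
  | cons s i ih =>
    intro hP hend
    have h0 : P (cfg M (some (Sum.inr Ctrl.load)) v S (s :: i) lf) := by
      simpa using hP [] (s :: i) rfl
    have h1 := ih (s :: lf)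
      (fun i₁ i₂ h => by simpa [List.append_assoc] using hP (s :: i₁) i₂ (by simp [h]))
      (by simpa [List.append_assoc] using hend)
    simpa [List.append_assoc] using
      SpaceLoop.RunsVia.step_trans (step_load_cons M dflt v S i lf s) h0 h1

/-- `feed`: `LEFT` is moved (reversed) back onto `IN` and, symbol by symbol, pushed on the input
stack `k₀` of `M`; then the machine jumps to the main label of `M`. [folklore] -/
theorem feed_run (i : List (M.Γ M.k₀)) : ∀ (lf : List (M.Γ M.k₀)) (S : ∀ k, List (M.Γ k)),
    (∀ l₁ l₂, l₁ ++ l₂ = lf →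
      P (cfg M (some (Sum.inr Ctrl.feed)) v (update S M.k₀ (l₁.reverse ++ S M.k₀))
        (l₁.reverse ++ i) l₂)) →
    P (cfg M (some (Sum.inl M.main)) v (update S M.k₀ (lf.reverse ++ S M.k₀))
      (lf.reverse ++ i) []) →
    SpaceLoop.RunsVia (C := TCfg M) (simTM M dflt).step P
      (cfg M (some (Sum.inr Ctrl.feed)) v S i lf)
      (cfg M (some (Sum.inl M.main)) v (update S M.k₀ (lf.reverse ++ S M.k₀))
        (lf.reverse ++ i) []) := by
  intro lf
  induction lf generalizing i with
  | nil =>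
    intro S hP hend
    have h0 := hP [] [] rfl
    simp only [List.reverse_nil, List.nil_append, update_eq_self] at h0 hend ⊢
    exact SpaceLoop.RunsVia.single (step_feed_nil M dflt v S i) h0 hend
  | cons s lf ih =>
    intro S hP hend
    have h0 : P (cfg M (some (Sum.inr Ctrl.feed)) v S i (s :: lf)) := by
      simpa using hP [] (s :: lf) rfl
    have h1 := ih (s :: i) (update S M.k₀ (s :: S M.k₀))
      (fun l₁ l₂ h => by
        have := hP (s :: l₁) l₂ (by simp [h])
        simp only [update_idem, update_self]
        simpa [List.append_assoc] using this)
      (by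
        simp only [update_idem, update_self]
        simpa [List.append_assoc] using hend)
    simp only [update_idem, update_self] at h1
    simpa [List.append_assoc] using
      SpaceLoop.RunsVia.step_trans (step_feed_cons M dflt v S i lf s) h0 h1

/-- **A run of the simulated machine** `M` is a run of the simulating machine on embedded
configurations, inside `P` if all embedded intermediate configurations are. [folklore] -/
theorem runM {n : ℕ} {a b : M.Cfg} (h : (flip bind M.step)^[n] (some a) = some b)
    (i : List (M.Γ M.k₀))
    (hP : ∀ j ≤ n, ∀ d, (flip bind M.step)^[j] (some a) = some d → P (cfgM M.k₀ d i)) :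
    SpaceLoop.RunsVia (C := TCfg M) (simTM M dflt).step P (cfgM M.k₀ a i) (cfgM M.k₀ b i) := by
  refine ⟨n, iterate_bind_map M.step (simTM M dflt).step (fun c => cfgM M.k₀ c i)
    (fun c d hcd => step_cfgM M dflt c d hcd i) n a b h, fun j hj c hc => ?_⟩
  obtain ⟨d, hd⟩ := SpaceLoop.exists_iterate_of_le h hj
  have := iterate_bind_map M.step (simTM M dflt).step (fun c => cfgM M.k₀ c i)
    (fun c d hcd => step_cfgM M dflt c d hcd i) j a d hd
  have e : some (cfgM M.k₀ d i) = some c := this.symm.trans hc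
  obtain rfl := Option.some.inj e
  exact hP j hj d hd

end Phases

/-! ### Initial and embedded configurations -/

/-- The initial configuration of the simulating machine. [folklore] -/
theorem initList_simTM (l : List (M.Γ M.k₀)) :
    initList (simTM M dflt) l =
      cfg M (some (Sum.inr Ctrl.load)) M.initialState (SpaceLoop.botStk M) l [] := by
  rw [initList_eq]
  change (⟨some (Sum.inr Ctrl.load), (M.initialState, none),
      update (fun j => ([] : List (TSΓ M.Γ M.k₀ j))) (Sum.inr Aux.IN) l⟩ : TCfg M) = _
  rw [← mkStk_bot_IN]
  rfl

/-- The embedded initial configuration of `M` on input `l`. [folklore] -/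
theorem cfgM_initList (l i : List (M.Γ M.k₀)) :
    cfgM M.k₀ (initList M l) i =
      cfg M (some (Sum.inl M.main)) M.initialState (update (SpaceLoop.botStk M) M.k₀ l) i [] := by
  rw [initList_eq]; rfl

/-- The embedded halting configuration of `M` with output `L`: the simulating machine has halted.
[folklore] -/
theorem cfgM_haltList (L : List (M.Γ M.k₁)) (i : List (M.Γ M.k₀)) :
    cfgM M.k₀ (haltList M L) i =
      cfg M none M.initialState (update (SpaceLoop.botStk M) M.k₁ L) i [] := by
  rw [haltList_eq]; rfl

/-! ### Work space and input invariant -/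

/-- The work space of a configuration of the simulating machine: the stacks of `M` (the input
stacks `IN`, `LEFT` are not charged; cf. `workSpace_eq_ws`). [cite: AroraBarak2009, Def. 4.1 (only work tapes are charged)] -/
noncomputable def ws (c : TCfg M) : ℕ :=
  SpaceLoop.stkLen M (fun k => c.stk (Sum.inl k))

/-- Work space of a `cfg`. [folklore] -/
@[simp] theorem ws_cfg (l : Option (M.Λ ⊕ Ctrl)) (v : M.σ) (S : ∀ k, List (M.Γ k))
    (i lf : List (M.Γ M.k₀)) : ws M (cfg M l v S i lf) = SpaceLoop.stkLen M S := rfl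

/-- Work space of an embedded configuration of `M`. [folklore] -/
@[simp] theorem ws_cfgM (c : M.Cfg) (i : List (M.Γ M.k₀)) :
    ws M (cfgM M.k₀ c i) = SpaceLoop.stkLen M c.stk := rfl

/-- Good configurations for input `x` and space bound `B`: work space `≤ B` and the read-only
input invariant `reverse LEFT ++ IN = x`. [cite: AroraBarak2009, Def. 4.1 (read-only input tape)] -/
def Good (B : ℕ) (x : List (M.Γ M.k₀)) (c : TCfg M) : Prop :=
  ws M c ≤ B ∧ (c.stk (Sum.inr Aux.LEFT)).reverse ++ c.stk (Sum.inr Aux.IN) = x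

/-- A `cfg` is good. [folklore] -/
theorem good_cfg {B : ℕ} {x : List (M.Γ M.k₀)} {l : Option (M.Λ ⊕ Ctrl)} {v : M.σ}
    {S : ∀ k, List (M.Γ k)} {i lf : List (M.Γ M.k₀)} (h1 : SpaceLoop.stkLen M S ≤ B)
    (h2 : lf.reverse ++ i = x) : Good M B x (cfg M l v S i lf) :=
  ⟨h1, h2⟩

/-- An embedded configuration of `M` (input back on `IN`) is good. [folklore] -/
theorem good_cfgM {B : ℕ} {x : List (M.Γ M.k₀)} {c : M.Cfg} (h1 : SpaceLoop.stkLen M c.stk ≤ B) :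
    Good M B x (cfgM M.k₀ c x) :=
  ⟨h1, rfl⟩

/-! ### The full trajectory -/

/-- **The full trajectory of the simulating machine.** If `M` runs from `initList l` to
`haltList out` in `n` steps, then from its initial configuration on `l` the simulating machine
reaches the embedded halting configuration through configurations of work space
`≤ |out| + machinePopBound · n ≤ B` satisfying the read-only input invariant: during `load`/`feed`
the work space is at most `|l|`, which is itself bounded by `|out| + machinePopBound · n` since `M`
consumes its input (`stkLen_le_of_run` at step `0`). [cite: AroraBarak2009, Thm. 4.2 (DTIME(S) ⊆ SPACE(S): a run of T steps touches O(T) cells)] -/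
theorem good_trajectory {n B : ℕ} {l : List (M.Γ M.k₀)} {out : List (M.Γ M.k₁)}
    (hrun : (flip bind M.step)^[n] (some (initList M l)) = some (haltList M out))
    (hB : out.length + machinePopBound M * n ≤ B) :
    SpaceLoop.RunsVia (C := TCfg M) (simTM M dflt).step (Good M B l)
      (cfg M (some (Sum.inr Ctrl.load)) M.initialState (SpaceLoop.botStk M) l [])
      (cfgM M.k₀ (haltList M out) l) := by
  -- every configuration of the run of `M`, in particular the first, holds at most `B` symbols
  have hM : ∀ j ≤ n, ∀ d, (flip bind M.step)^[j] (some (initList M l)) = some d →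
      SpaceLoop.stkLen M d.stk ≤ B := by
    intro j hj d hd
    have h1 := stkLen_le_of_run M hrun hj hd
    rw [stkLen_haltList] at h1
    exact h1.trans hB
  have hl : l.length ≤ B := by
    have := hM 0 (Nat.zero_le _) (initList M l) rfl
    rwa [SpaceLoop.stkLen_initList] at this
  -- phase `load`
  have h0 := load_run M dflt (Good M B l) M.initialState (SpaceLoop.botStk M) [] l
    (fun i₁ i₂ h => good_cfg M (by simp) (by simpa using h))
    (good_cfg M (by simp) (by simp))
  -- phase `feed`
  have h1 := feed_run M dflt (Good M B l) M.initialState [] (l.reverse ++ []) (SpaceLoop.botStk M)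
    (fun l₁ l₂ h => good_cfg M
      (by
        have e := congrArg List.length h
        simp only [List.length_append, List.length_reverse, List.append_nil] at e
        simp only [SpaceLoop.stkLen_update_bot, List.length_append, List.length_reverse,
          List.length_nil, add_zero]
        omega)
      (by
        have e := congrArg List.reverse h
        simpa using e))
    (good_cfg M (by simpa using hl) (by simp))
  have hstart : cfgM M.k₀ (initList M l) l = cfg M (some (Sum.inl M.main)) M.initialState
      (update (SpaceLoop.botStk M) M.k₀ ((l.reverse ++ []).reverse ++ SpaceLoop.botStk M M.k₀))
      ((l.reverse ++ []).reverse ++ []) [] := by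
    rw [cfgM_initList]; simp
  rw [← hstart] at h1
  -- the run of `M`
  have h2 := runM M dflt (Good M B l) hrun l (fun j hj d hd => good_cfgM M (hM j hj d hd))
  exact h0.trans (h1.trans h2)

/-! ### The space machine -/

variable {Γ₀ Γ₁ : Type}

/-- **The simulating machine as a space machine**: read-only input on `LEFT`/`IN` (alphabet
identifications those of `Mx`), output on the output stack `inl k₁` of the simulated machine.
[cite: AroraBarak2009, Def. 4.1 and Thm. 4.2] -/
noncomputable def spaceMachine (Mx : TM2ComputableAux Γ₀ Γ₁) (dflt : Mx.tm.Γ Mx.tm.k₀) :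
    SpaceMachine Γ₀ Γ₁ where
  tm := simTM Mx.tm dflt
  inputAlphabet := Mx.inputAlphabet
  outputAlphabet := Mx.outputAlphabet
  kL := Sum.inr Aux.LEFT
  kL_ne_k₀ := by simp [simTM]
  kL_ne_k₁ := by simp [simTM]
  leftAlphabet := Mx.inputAlphabet

/-- The initial configuration of the space machine. [folklore] -/
theorem spaceMachine_init (Mx : TM2ComputableAux Γ₀ Γ₁) (dflt : Mx.tm.Γ Mx.tm.k₀) (x : List Γ₀) :
    (spaceMachine Mx dflt).init x = cfg Mx.tm (some (Sum.inr Ctrl.load)) Mx.tm.initialState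
      (SpaceLoop.botStk Mx.tm) (x.map Mx.inputAlphabet.symm) [] :=
  initList_simTM Mx.tm dflt _

/-- The charged stacks of the space machine are the stacks of `M`. [folklore] -/
theorem workStacks_eq :
    letI := M.kFin
    ((Finset.univ : Finset (M.K ⊕ Aux)).erase (Sum.inr Aux.IN)).erase (Sum.inr Aux.LEFT) =
      Finset.univ.image Sum.inl := by
  ext j
  rcases j with k | a
  · simp
  · cases a <;> simp

/-- **The work space of the space machine is `ws`.** [cite: AroraBarak2009, Def. 4.1] -/
theorem workSpace_eq_ws (Mx : TM2ComputableAux Γ₀ Γ₁) (dflt : Mx.tm.Γ Mx.tm.k₀) (c : TCfg Mx.tm) :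
    (spaceMachine Mx dflt).workSpace c = ws Mx.tm c := by
  letI := Mx.tm.kFin
  unfold SpaceMachine.workSpace
  change ∑ k ∈ ((Finset.univ : Finset (Mx.tm.K ⊕ Aux)).erase (Sum.inr Aux.IN)).erase
    (Sum.inr Aux.LEFT), (c.stk k).length = _
  rw [workStacks_eq, Finset.sum_image (fun a _ b _ h => Sum.inl_injective h)]
  rfl

/-- **The simulating machine decides in bounded space.** If `Mx` decides `L` within `T |x|` steps,
then its space machine decides `L` in work space `1 + machinePopBound · T |x|`, respecting the
read-only input: the whole trajectory (`good_trajectory`) lies inside `Good`, it ends in the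
embedded halting configuration of `Mx` (answer `[x ∈ L]` on `inl k₁`), and every reachable
configuration is on it (`SpaceLoop.RunsVia.forall_reaches`). [cite: AroraBarak2009, Thm. 4.2 (DTIME(S(n)) ⊆ SPACE(S(n)))] -/
theorem decidesInSpace {Mx : TM2ComputableAux Bool Bool} {L : Language Bool} {T : ℕ → ℕ}
    (hMx : DecidesInTime id L (fun x => T x.length) Mx) :
    DecidesInSpace (spaceMachine Mx (Mx.inputAlphabet.symm false)) L
      (fun x => 1 + machinePopBound Mx.tm * T x.length) := by
  set dflt := Mx.inputAlphabet.symm false with hdflt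
  -- the trajectory of every input
  have traj : ∀ x : List Bool, SpaceLoop.RunsVia (C := TCfg Mx.tm) (simTM Mx.tm dflt).step
      (Good Mx.tm (1 + machinePopBound Mx.tm * T x.length) (x.map Mx.inputAlphabet.symm))
      ((spaceMachine Mx dflt).init x)
      (cfgM Mx.tm.k₀ (haltList Mx.tm [Mx.outputAlphabet.symm (L.boolIndicator x)])
        (x.map Mx.inputAlphabet.symm)) := by
    intro x
    have hx : Mx.OutputsWithin x (encodeBool (L.boolIndicator x)) (T x.length) := hMx x
    obtain ⟨n, hn, e⟩ := TM2Iter.reachesIn_of_outputsWithin Mx hx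
    rw [spaceMachine_init]
    exact good_trajectory Mx.tm dflt (out := [Mx.outputAlphabet.symm (L.boolIndicator x)]) e
      (by simpa using Nat.mul_le_mul_left (machinePopBound Mx.tm) hn)
  have hnone : ∀ x : List Bool, (simTM Mx.tm dflt).step (cfgM Mx.tm.k₀
      (haltList Mx.tm [Mx.outputAlphabet.symm (L.boolIndicator x)]) (x.map Mx.inputAlphabet.symm)) =
        none := by
    intro x; rw [cfgM_haltList]; rfl
  refine ⟨fun x c hc => ?_, fun x => ⟨?_, fun c hc => ?_⟩⟩
  · -- read-only input
    have hg := ((traj x).forall_reaches (hnone x) c hc).2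
    have := congrArg (List.map Mx.inputAlphabet) hg
    show ((c.stk (Sum.inr Aux.LEFT)).map Mx.inputAlphabet).reverse ++
      (c.stk (Sum.inr Aux.IN)).map Mx.inputAlphabet = x
    simpa using this
  · -- halting with the right answer
    refine ⟨_, (traj x).mem_eval (hnone x), ?_⟩
    rw [cfgM_haltList]
    show (update (SpaceLoop.botStk Mx.tm) Mx.tm.k₁ [Mx.outputAlphabet.symm (L.boolIndicator x)]
      Mx.tm.k₁).map Mx.outputAlphabet = [L.boolIndicator x]
    simp
  · -- space
    have hg := ((traj x).forall_reaches (hnone x) c hc).1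
    rw [workSpace_eq_ws]
    exact hg

end Bundled

/-- **Exact classes: `TimeClass T ⊆ SpaceClass (1 + P · T)`** for the pop bound `P` of (the
machine witnessing) each member. [cite: AroraBarak2009, Thm. 4.2 (DTIME(S(n)) ⊆ SPACE(S(n)))] -/
theorem timeClass_subset_spaceClass {T : ℕ → ℕ} {L : Language Bool} (hL : L ∈ TimeClass T) :
    ∃ P : ℕ, L ∈ SpaceClass (fun n => 1 + P * T n) := by
  obtain ⟨Mx, hMx⟩ := hL
  exact ⟨machinePopBound Mx.tm, _, decidesInSpace hMx⟩

end TimeToSpace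

end Literature.Computability.Complexity
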